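import Mathlib
import Literature.NumberTheory.LFunctions.Zhang2022.AppendixALemma83PowSum
import HarnessLib

/-!
# Zhang (2022), Appendix A part 1 (proof of Lemma 8.3): Case 1 (`(q,dh) = 1`) — Z22:§A.u012
# (corrected), Z22:§A.u013, the deduction `DedA1` and (A.1) — kernel-checked

Topic `Literature/NumberTheory/LFunctions/Zhang2022` (Landau–Siegel audit tree; verdict-neutral).
Y. Zhang, *Discrete mean estimates and the Landau–Siegel zero*, arXiv:2211.02515v1 (2022)
[Zhang2022LandauSiegel], Appendix A p. 102 (tex L5021–L5053), **an unrefereed manuscript under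
adjudication**. In Case 1 the inner sum is `ξ_j(q^r;d,h) = Σ_{i≥0} κ(q^{r+i})q^{−i(1−β_j)} −
κ(q^{r−1})q^{1−β_j}/(q−1)` (typed node `StepA_u010` + `AppendixALemma83Local`); with
`κ(q^m) = (m+1)(1 + O(αm log q))`, `q^{−i(1−β_j)} = u^i(1 + O(αi log q))` this is
`Σ_η (r+η+1)u^η − r/(1−u) + O(α r³ log q) = 1/(1−u)² + O(α r³ log q)`. This file PROVES

* `stepA_u012_corrected` — `‖ξ_j(q^r;d,h) − 1/(1−u)²‖ ≤ 2052·B log q·(r+1)³`, `B = |b₁|+|b₂|+|b₃|`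
  (the printed Z22:§A.u012 claims `O(αr log q/q)`, flag F5 of `TypedAppendixA1`: for `r = 1` the
  `i = 0` term `κ(q)` already deviates from `2` by `≍ α log q`, so the printed `q⁻¹` is not available
  pointwise; the `q⁻¹` appears only after the weight `q^{−rs}`, `r ≥ 1`, i.e. in u013);
* `stepA_u013_holds` — **Z22:§A.u013**: `Σ_r χ(q^r)ξ_j(q^r;d,h)/q^{rs} = (1−u)^{−2}(1/(1−vu) − 1)
  + O(α log q/q)`;
* `dedA1_holds` — the printed deduction `DedA1` ("This together with … yields (A.1)");
* hence **(A.1) holds**: `eqA_1_holds : EqA_1 c′`,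

for `D` large in terms of `c′`, with explicit absolute constants. Nothing here bears on
Theorems 1–2 of the manuscript.

## References

* Y. Zhang, arXiv:2211.02515v1 (2022), Appendix A p. 102. [cite: Zhang2022LandauSiegel, App. A]
-/

noncomputable section

open Complex Real ComplexConjugate Finset

namespace Literature.NumberTheory.LFunctions.Zhang2022.Lemma83

open Literature.NumberTheory.LFunctions.Zhang2022
open Literature.NumberTheory.LFunctions.Zhang2022.Skeleton
open Literature.NumberTheory.LFunctions.Zhang2022.MeanSquareMajorant
open Literature.NumberTheory.LFunctions.Zhang2022.Typed.AppendixA1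

/-! ## Private numeric helpers -/

/-- `(i+2)⁴ ≤ 256·(7/4)^i`. [folklore] -/
private theorem pow_four_le (i : ℕ) : ((i : ℝ) + 2) ^ 4 ≤ 256 * (7 / 4 : ℝ) ^ i := by
  have step : ∀ n : ℕ, 6 ≤ n → ((n : ℝ) + 2) ^ 4 ≤ 256 * (7 / 4 : ℝ) ^ n →
      (((n + 1 : ℕ) : ℝ) + 2) ^ 4 ≤ 256 * (7 / 4 : ℝ) ^ (n + 1) := by
    intro n hn ih
    have hn' : (6 : ℝ) ≤ n := by exact_mod_cast hn
    -- `(n+3)^4 ≤ (7/4)(n+2)^4` for `n ≥ 6` (indeed `((n+3)/(n+2))^4 ≤ (9/8)^4 < 7/4`)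
    have key : ((n : ℝ) + 1 + 2) ^ 4 ≤ (7 / 4) * ((n : ℝ) + 2) ^ 4 := by
      have h1 : ((n : ℝ) + 3) ≤ (9 / 8) * ((n : ℝ) + 2) := by linarith
      have h2 : 0 ≤ (n : ℝ) + 3 := by linarith
      calc ((n : ℝ) + 1 + 2) ^ 4 = ((n : ℝ) + 3) ^ 4 := by ring
        _ ≤ ((9 / 8) * ((n : ℝ) + 2)) ^ 4 := pow_le_pow_left₀ h2 h1 4
        _ = (9 / 8) ^ 4 * ((n : ℝ) + 2) ^ 4 := by ring
        _ ≤ (7 / 4) * ((n : ℝ) + 2) ^ 4 := by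
            apply mul_le_mul_of_nonneg_right (by norm_num) (by positivity)
    calc (((n + 1 : ℕ) : ℝ) + 2) ^ 4 = ((n : ℝ) + 1 + 2) ^ 4 := by push_cast; ring
      _ ≤ (7 / 4) * ((n : ℝ) + 2) ^ 4 := key
      _ ≤ (7 / 4) * (256 * (7 / 4 : ℝ) ^ n) := by gcongr
      _ = 256 * (7 / 4 : ℝ) ^ (n + 1) := by ring
  rcases Nat.lt_or_ge i 6 with hi | hi
  · interval_cases i <;> norm_num
  · induction i, hi using Nat.le_induction with
    | base => norm_num
    | succ n hn ih => exact step n hn ih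

/-- `(r+2)³ ≤ 64·(3/2)^r`. [folklore] -/
private theorem pow_three_le (r : ℕ) : ((r : ℝ) + 2) ^ 3 ≤ 64 * (3 / 2 : ℝ) ^ r := by
  have step : ∀ n : ℕ, 5 ≤ n → ((n : ℝ) + 2) ^ 3 ≤ 64 * (3 / 2 : ℝ) ^ n →
      (((n + 1 : ℕ) : ℝ) + 2) ^ 3 ≤ 64 * (3 / 2 : ℝ) ^ (n + 1) := by
    intro n hn ih
    have hn' : (5 : ℝ) ≤ n := by exact_mod_cast hn
    have key : ((n : ℝ) + 1 + 2) ^ 3 ≤ (3 / 2) * ((n : ℝ) + 2) ^ 3 := by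
      have h1 : ((n : ℝ) + 3) ≤ (8 / 7) * ((n : ℝ) + 2) := by linarith
      have h2 : 0 ≤ (n : ℝ) + 3 := by linarith
      calc ((n : ℝ) + 1 + 2) ^ 3 = ((n : ℝ) + 3) ^ 3 := by ring
        _ ≤ ((8 / 7) * ((n : ℝ) + 2)) ^ 3 := pow_le_pow_left₀ h2 h1 3
        _ = (8 / 7) ^ 3 * ((n : ℝ) + 2) ^ 3 := by ring
        _ ≤ (3 / 2) * ((n : ℝ) + 2) ^ 3 := by
            apply mul_le_mul_of_nonneg_right (by norm_num) (by positivity)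
    calc (((n + 1 : ℕ) : ℝ) + 2) ^ 3 = ((n : ℝ) + 1 + 2) ^ 3 := by push_cast; ring
      _ ≤ (3 / 2) * ((n : ℝ) + 2) ^ 3 := key
      _ ≤ (3 / 2) * (64 * (3 / 2 : ℝ) ^ n) := by gcongr
      _ = 64 * (3 / 2 : ℝ) ^ (n + 1) := by ring
  rcases Nat.lt_or_ge r 5 with hr | hr
  · interval_cases r <;> norm_num
  · induction r, hr using Nat.le_induction with
    | base => norm_num
    | succ n hn ih => exact step n hn ih

/-- Inner sums: if `‖f(i)‖ ≤ E(i+2)⁴ρ^i` with `0 ≤ ρ ≤ 1/2` then `Σ_i f(i)` converges absolutely with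
norm `≤ 2048E`. [folklore] -/
private theorem tsum_quartic_geom_bound {f : ℕ → ℂ} {E ρ : ℝ} (hE : 0 ≤ E) (hρ0 : 0 ≤ ρ)
    (hρ : ρ ≤ 1 / 2) (hf : ∀ i : ℕ, ‖f i‖ ≤ E * ((i : ℝ) + 2) ^ 4 * ρ ^ i) :
    Summable f ∧ ‖∑' i : ℕ, f i‖ ≤ 2048 * E := by
  have hterm : ∀ i : ℕ, ‖f i‖ ≤ 256 * E * (7 / 8 : ℝ) ^ i := fun i => by
    calc ‖f i‖ ≤ E * ((i : ℝ) + 2) ^ 4 * ρ ^ i := hf i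
      _ ≤ E * (256 * (7 / 4 : ℝ) ^ i) * (1 / 2 : ℝ) ^ i := by
          gcongr
          exact pow_four_le i
      _ = 256 * E * ((7 / 4 : ℝ) ^ i * (1 / 2) ^ i) := by ring
      _ = 256 * E * (7 / 8 : ℝ) ^ i := by rw [← mul_pow]; norm_num
  have hgeo : HasSum (fun i : ℕ => 256 * E * (7 / 8 : ℝ) ^ i) (256 * E * 8) := by
    have h := (hasSum_geometric_of_lt_one (by norm_num : (0 : ℝ) ≤ 7 / 8) (by norm_num)).mul_left
      (256 * E)
    have e : 256 * E * (1 - 7 / 8 : ℝ)⁻¹ = 256 * E * 8 := by norm_num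
    rwa [e] at h
  refine ⟨Summable.of_norm_bounded hgeo.summable hterm, ?_⟩
  calc ‖∑' i : ℕ, f i‖ ≤ 256 * E * 8 := tsum_of_norm_bounded hgeo hterm
    _ = 2048 * E := by ring

/-- Outer sums: if `‖Z‖ ≤ 3/5` and `‖f(r)‖ ≤ E(r+2)³` then `Σ_r Z^{r+1}f(r)` converges absolutely
with norm `≤ 640E‖Z‖`. [folklore] -/
private theorem tsum_pow_succ_mul_cubic_bound {Z : ℂ} (hZ : ‖Z‖ ≤ 3 / 5) {f : ℕ → ℂ} {E : ℝ}
    (hE : 0 ≤ E) (hf : ∀ r : ℕ, ‖f r‖ ≤ E * ((r : ℝ) + 2) ^ 3) :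
    Summable (fun r : ℕ => Z ^ (r + 1) * f r) ∧ ‖∑' r : ℕ, Z ^ (r + 1) * f r‖ ≤ 640 * E * ‖Z‖ := by
  have hterm : ∀ r : ℕ, ‖Z ^ (r + 1) * f r‖ ≤ 64 * E * ‖Z‖ * (9 / 10 : ℝ) ^ r := fun r => by
    rw [norm_mul, norm_pow, pow_succ]
    have h1 : ‖Z‖ ^ r ≤ (3 / 5 : ℝ) ^ r := pow_le_pow_left₀ (norm_nonneg _) hZ r
    calc ‖Z‖ ^ r * ‖Z‖ * ‖f r‖ ≤ (3 / 5 : ℝ) ^ r * ‖Z‖ * (E * ((r : ℝ) + 2) ^ 3) := by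
          gcongr; exact hf r
      _ ≤ (3 / 5 : ℝ) ^ r * ‖Z‖ * (E * (64 * (3 / 2 : ℝ) ^ r)) := by
          gcongr; exact pow_three_le r
      _ = 64 * E * ‖Z‖ * ((3 / 5 : ℝ) ^ r * (3 / 2) ^ r) := by ring
      _ = 64 * E * ‖Z‖ * (9 / 10 : ℝ) ^ r := by rw [← mul_pow]; norm_num
  have hgeo : HasSum (fun r : ℕ => 64 * E * ‖Z‖ * (9 / 10 : ℝ) ^ r) (64 * E * ‖Z‖ * 10) := by
    have h := (hasSum_geometric_of_lt_one (by norm_num : (0 : ℝ) ≤ 9 / 10) (by norm_num)).mul_left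
      (64 * E * ‖Z‖)
    have e : 64 * E * ‖Z‖ * (1 - 9 / 10 : ℝ)⁻¹ = 64 * E * ‖Z‖ * 10 := by norm_num
    rwa [e] at h
  refine ⟨Summable.of_norm_bounded hgeo.summable hterm, ?_⟩
  calc ‖∑' r : ℕ, Z ^ (r + 1) * f r‖ ≤ 64 * E * ‖Z‖ * 10 := tsum_of_norm_bounded hgeo hterm
    _ = 640 * E * ‖Z‖ := by ring

/-- `Σ_{r≥0} Z^{r+1} = 1/(1−Z) − 1` for `‖Z‖ < 1`. [folklore] -/
private theorem hasSum_pow_succ' {Z : ℂ} (hZ : ‖Z‖ < 1) :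
    HasSum (fun r : ℕ => Z ^ (r + 1)) (1 / (1 - Z) - 1) := by
  have h1 : 1 - Z ≠ 0 := sub_ne_zero.mpr (fun h => by rw [← h, norm_one] at hZ; exact lt_irrefl _ hZ)
  have h := (hasSum_geometric_of_norm_lt_one hZ).mul_left Z
  simp only [← pow_succ'] at h
  have e : Z * (1 - Z)⁻¹ = 1 / (1 - Z) - 1 := by field_simp; ring
  rwa [e] at h

/-- `Σ_{i≥0} (n+i+1)u^i = (n+1)/(1−u) + u/(1−u)²` for `‖u‖ < 1`. [folklore] -/
private theorem hasSum_affine_mul_geometric {u : ℂ} (hu : ‖u‖ < 1) (n : ℕ) :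
    HasSum (fun i : ℕ => ((n : ℂ) + i + 1) * u ^ i) (((n : ℂ) + 1) / (1 - u) + u / (1 - u) ^ 2) := by
  have h1 := (hasSum_geometric_of_norm_lt_one hu).mul_left ((n : ℂ) + 1)
  have h2 := hasSum_coe_mul_geometric_of_norm_lt_one hu
  have h := h1.add h2
  have hf : (fun i : ℕ => ((n : ℂ) + i + 1) * u ^ i) =
      fun b : ℕ => ((n : ℂ) + 1) * u ^ b + (b : ℂ) * u ^ b := by
    funext i; ring
  have e : ((n : ℂ) + 1) * (1 - u)⁻¹ + u / (1 - u) ^ 2 =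
      ((n : ℂ) + 1) / (1 - u) + u / (1 - u) ^ 2 := by ring
  rw [hf, ← e]; exact h

/-- `‖1/(1−a) − 1/(1−b)‖ ≤ (25/4)‖a − b‖` for `‖a‖, ‖b‖ ≤ 3/5`. [folklore] -/
private theorem norm_inv_sub_inv_le' {a b : ℂ} (ha : ‖a‖ ≤ 3 / 5) (hb : ‖b‖ ≤ 3 / 5) :
    ‖1 / (1 - a) - 1 / (1 - b)‖ ≤ 25 / 4 * ‖a - b‖ := by
  have hna : 2 / 5 ≤ ‖1 - a‖ := by
    linarith [norm_le_norm_add_norm_sub' (1 : ℂ) a, norm_one (α := ℂ)]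
  have hnb : 2 / 5 ≤ ‖1 - b‖ := by
    linarith [norm_le_norm_add_norm_sub' (1 : ℂ) b, norm_one (α := ℂ)]
  have ha0 : 1 - a ≠ 0 := fun h => by rw [h, norm_zero] at hna; linarith
  have hb0 : 1 - b ≠ 0 := fun h => by rw [h, norm_zero] at hnb; linarith
  have e : 1 / (1 - a) - 1 / (1 - b) = (a - b) / ((1 - a) * (1 - b)) := by field_simp; ring
  rw [e, norm_div, norm_mul]
  rw [div_le_iff₀ (by positivity)]
  nlinarith [norm_nonneg (a - b), mul_le_mul hna hnb (by norm_num) (norm_nonneg _)]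

/-- `‖n^w − 1‖ ≤ ‖w‖ log n` for a purely imaginary exponent `w` and a natural `n ≥ 1`. [folklore] -/
private theorem norm_natCast_cpow_sub_one_le_of_re_eq_zero {n : ℕ} (hn : 0 < n) {w : ℂ}
    (hw : w.re = 0) : ‖(n : ℂ) ^ w - 1‖ ≤ ‖w‖ * Real.log n := by
  have hn0 : (n : ℂ) ≠ 0 := by exact_mod_cast hn.ne'
  have him : w = ((w.im : ℝ) : ℂ) * I := by
    apply Complex.ext <;> simp [hw]
  have hnorm : ‖w‖ = |w.im| := by
    rw [congrArg (fun z : ℂ => ‖z‖) him]; simp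
  have e0 : (Real.log n : ℂ) * w = I * ((Real.log n * w.im : ℝ) : ℂ) := by
    apply Complex.ext <;> simp [hw]
  rw [Complex.cpow_def_of_ne_zero hn0, ← Complex.natCast_log, e0]
  calc ‖Complex.exp (I * ((Real.log n * w.im : ℝ) : ℂ)) - 1‖ ≤ ‖(Real.log n * w.im : ℝ)‖ :=
        Real.norm_exp_I_mul_ofReal_sub_one_le
    _ = ‖w‖ * Real.log n := by
        rw [Real.norm_eq_abs, abs_mul, abs_of_nonneg (Real.log_natCast_nonneg n), mul_comm, hnorm]

/-! ## The Case-1 coefficients -/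

/-- The `i`-th term of `κ̃₀ⱼ(q^n;dh) = Σ_i κ(q^{n+i})q^{−i(1−β_j)}` is within
`B log q·(n+1)³(i+2)⁴·q^{−i}` of `(n+i+1)u^i` (`B = |b₁|+|b₂|+|b₃| ≥ ‖β_j‖`; crude polynomial
domination, using `‖κ(q^m)‖ ≤ (m+1)³`). [cite: Zhang2022LandauSiegel, App. A p. 102] -/
theorem case1_term_bound (c' : ℝ) (D : ℕ) (j : ℕ) {q : ℕ} (hq : q.Prime) (n i : ℕ) :
    ‖kappaZ c' D (q ^ (n + i)) / ((q ^ i : ℕ) : ℂ) ^ (1 - betaJ c' D j) -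
        ((n : ℂ) + i + 1) * ((q : ℂ)⁻¹) ^ i‖ ≤
      (|b1 c' D| + |b2 c' D| + |b3 c' D|) * Real.log q * ((n : ℝ) + 1) ^ 3 *
        (((i : ℝ) + 2) ^ 4 * ((q : ℝ)⁻¹) ^ i) := by
  set B : ℝ := |b1 c' D| + |b2 c' D| + |b3 c' D| with hBdef
  have hB0 : 0 ≤ B := by positivity
  have hlog : 0 ≤ Real.log q := Real.log_natCast_nonneg q
  have hBL : 0 ≤ B * Real.log q := mul_nonneg hB0 hlog
  have hqi : (0 : ℕ) < q ^ i := pow_pos hq.pos i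
  have hx0 : ((q ^ i : ℕ) : ℂ) ≠ 0 := by exact_mod_cast hqi.ne'
  have hre : (betaJ c' D j).re = 0 := by
    unfold betaJ beta1 beta2 beta3; split_ifs <;> simp
  set x : ℂ := ((q ^ i : ℕ) : ℂ) with hxdef
  have hY : kappaZ c' D (q ^ (n + i)) / x ^ (1 - betaJ c' D j) =
      kappaZ c' D (q ^ (n + i)) * (x⁻¹ * x ^ (betaJ c' D j)) := by
    rw [div_eq_mul_inv, ← Complex.cpow_neg, neg_sub,
      show betaJ c' D j - 1 = -1 + betaJ c' D j by ring, Complex.cpow_add _ _ hx0,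
      Complex.cpow_neg_one]
  have hxinv : x⁻¹ = ((q : ℂ)⁻¹) ^ i := by rw [hxdef, Nat.cast_pow, inv_pow]
  have hxinvn : ‖x⁻¹‖ = ((q : ℝ)⁻¹) ^ i := by
    rw [hxinv, norm_pow, norm_inv, Complex.norm_natCast]
  have hxb1 : ‖x ^ (betaJ c' D j) - 1‖ ≤ B * (i * Real.log q) := by
    have h := norm_natCast_cpow_sub_one_le_of_re_eq_zero hqi hre
    have hlogpow : Real.log ((q ^ i : ℕ) : ℝ) = i * Real.log q := by
      rw [Nat.cast_pow, Real.log_pow]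
    rw [hlogpow] at h
    exact le_trans h (mul_le_mul_of_nonneg_right (norm_betaJ_le c' D j) (by positivity))
  have hκ : ‖kappaZ c' D (q ^ (n + i)) - ((n : ℂ) + i + 1)‖ ≤
      ((n : ℝ) + i + 1) * ((n : ℝ) + i) * B * Real.log q := by
    have h := norm_kappa_prime_pow_sub_le (b1 c' D) (b2 c' D) (b3 c' D) hq (n + i)
    rw [kappaZ]
    have e1 : (((n + i : ℕ) : ℂ) + 1) = (n : ℂ) + i + 1 := by push_cast; ring
    rw [e1] at h
    calc _ ≤ ((n + i : ℕ) + 1) * (n + i : ℕ) * B * Real.log q := h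
      _ = ((n : ℝ) + i + 1) * ((n : ℝ) + i) * B * Real.log q := by push_cast; ring
  have hκn : ‖kappaZ c' D (q ^ (n + i))‖ ≤ ((n : ℝ) + i + 1) ^ 3 := by
    have h := norm_kappa_prime_pow_le (b1 c' D) (b2 c' D) (b3 c' D) hq (n + i)
    rw [kappaZ]
    calc _ ≤ (((n + i : ℕ) : ℝ) + 1) ^ 3 := h
      _ = ((n : ℝ) + i + 1) ^ 3 := by push_cast; ring
  rw [hY]
  have e : kappaZ c' D (q ^ (n + i)) * (x⁻¹ * x ^ betaJ c' D j) - ((n : ℂ) + i + 1) * ((q : ℂ)⁻¹) ^ i =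
      (kappaZ c' D (q ^ (n + i)) - ((n : ℂ) + i + 1)) * x⁻¹ +
        kappaZ c' D (q ^ (n + i)) * x⁻¹ * (x ^ betaJ c' D j - 1) := by
    rw [← hxinv]; ring
  rw [e]
  have hρ : 0 ≤ ((q : ℝ)⁻¹) ^ i := by positivity
  have hi0 : (0 : ℝ) ≤ i := Nat.cast_nonneg i
  have hn0 : (0 : ℝ) ≤ n := Nat.cast_nonneg n
  calc _ ≤ ‖(kappaZ c' D (q ^ (n + i)) - ((n : ℂ) + i + 1)) * x⁻¹‖ +
        ‖kappaZ c' D (q ^ (n + i)) * x⁻¹ * (x ^ betaJ c' D j - 1)‖ := norm_add_le _ _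
    _ ≤ ((n : ℝ) + i + 1) * ((n : ℝ) + i) * B * Real.log q * ((q : ℝ)⁻¹) ^ i +
        ((n : ℝ) + i + 1) ^ 3 * ((q : ℝ)⁻¹) ^ i * (B * (i * Real.log q)) := by
        rw [norm_mul, norm_mul, norm_mul, hxinvn]
        exact add_le_add (mul_le_mul_of_nonneg_right hκ hρ)
          (mul_le_mul (mul_le_mul_of_nonneg_right hκn hρ) hxb1 (norm_nonneg _) (by positivity))
    _ = (B * Real.log q) * ((q : ℝ)⁻¹) ^ i *
          (((n : ℝ) + i + 1) * ((n : ℝ) + i) + ((n : ℝ) + i + 1) ^ 3 * i) := by ring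
    _ ≤ (B * Real.log q) * ((q : ℝ)⁻¹) ^ i * (((n : ℝ) + 1) ^ 3 * ((i : ℝ) + 2) ^ 4) := by
        apply mul_le_mul_of_nonneg_left _ (mul_nonneg hBL hρ)
        -- `(m+1)m + (m+1)³ i ≤ (n+1)³(i+2)⁴` with `m = n+i`: since `m+1 ≤ (n+1)(i+1)`
        have hm : (n : ℝ) + i + 1 ≤ ((n : ℝ) + 1) * ((i : ℝ) + 1) := by nlinarith
        have hm0 : 0 ≤ (n : ℝ) + i + 1 := by positivity
        have h3 : ((n : ℝ) + i + 1) ^ 3 ≤ (((n : ℝ) + 1) * ((i : ℝ) + 1)) ^ 3 :=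
          pow_le_pow_left₀ hm0 hm 3
        have h2 : ((n : ℝ) + i + 1) * ((n : ℝ) + i) ≤ (((n : ℝ) + 1) * ((i : ℝ) + 1)) ^ 2 := by
          nlinarith
        have hA : (((n : ℝ) + 1) * ((i : ℝ) + 1)) ^ 2 ≤ ((n : ℝ) + 1) ^ 3 * ((i : ℝ) + 2) ^ 3 := by
          have : ((n : ℝ) + 1) ^ 2 ≤ ((n : ℝ) + 1) ^ 3 := by nlinarith
          have : ((i : ℝ) + 1) ^ 2 ≤ ((i : ℝ) + 2) ^ 3 := by nlinarith
          calc (((n : ℝ) + 1) * ((i : ℝ) + 1)) ^ 2 = ((n : ℝ) + 1) ^ 2 * ((i : ℝ) + 1) ^ 2 := by ring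
            _ ≤ ((n : ℝ) + 1) ^ 3 * ((i : ℝ) + 2) ^ 3 := by gcongr
        have hB' : (((n : ℝ) + 1) * ((i : ℝ) + 1)) ^ 3 * i ≤ ((n : ℝ) + 1) ^ 3 * (((i : ℝ) + 2) ^ 3 * ((i : ℝ) + 1)) := by
          have : ((i : ℝ) + 1) ^ 3 * i ≤ ((i : ℝ) + 2) ^ 3 * ((i : ℝ) + 1) :=
            mul_le_mul (pow_le_pow_left₀ (by positivity) (by linarith) 3) (by linarith) hi0
              (by positivity)
          calc (((n : ℝ) + 1) * ((i : ℝ) + 1)) ^ 3 * i = ((n : ℝ) + 1) ^ 3 * (((i : ℝ) + 1) ^ 3 * i) := by ring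
            _ ≤ ((n : ℝ) + 1) ^ 3 * (((i : ℝ) + 2) ^ 3 * ((i : ℝ) + 1)) := by gcongr
        calc ((n : ℝ) + i + 1) * ((n : ℝ) + i) + ((n : ℝ) + i + 1) ^ 3 * i
            ≤ (((n : ℝ) + 1) * ((i : ℝ) + 1)) ^ 2 + (((n : ℝ) + 1) * ((i : ℝ) + 1)) ^ 3 * i := by
              gcongr
          _ ≤ ((n : ℝ) + 1) ^ 3 * ((i : ℝ) + 2) ^ 3 + ((n : ℝ) + 1) ^ 3 * (((i : ℝ) + 2) ^ 3 * ((i : ℝ) + 1)) :=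
              add_le_add hA hB'
          _ = ((n : ℝ) + 1) ^ 3 * ((i : ℝ) + 2) ^ 3 * ((i : ℝ) + 2) := by ring
          _ = ((n : ℝ) + 1) ^ 3 * ((i : ℝ) + 2) ^ 4 := by ring
    _ = B * Real.log q * ((n : ℝ) + 1) ^ 3 * (((i : ℝ) + 2) ^ 4 * ((q : ℝ)⁻¹) ^ i) := by ring

/-- **Z22:§A.u012, CORRECTED form** (Case 1, `(q,dh) = 1`, `n ≥ 1`; App. A p. 102, tex L5038):
`‖ξ_j(q^n;d,h) − 1/(1−u)²‖ ≤ 2052·B log q·(n+1)³` with `B = |b₁|+|b₂|+|b₃|`, for every prime `q`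
(`ξ_j(q^n;d,h) = Σ_i κ(q^{n+i})q^{−i(1−β_j)} − κ(q^{n−1})q^{1−β_j}/(q−1)`,
`Σ_i (n+i+1)u^i − n/(1−u) = 1/(1−u)²`). The printed display asserts `O(αn log q/q)` (flag F5): the
`q⁻¹` is not available pointwise. [cite: Zhang2022LandauSiegel, App. A p. 102] -/
theorem stepA_u012_corrected (c' : ℝ) (D : ℕ) (j d h : ℕ) {q : ℕ} (hq : q.Prime) (hd : 1 ≤ d)
    (hh : 1 ≤ h) (hqD : q < D) (hcop : Nat.Coprime q D) (hqdh : Nat.Coprime q (d * h)) {n : ℕ}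
    (hn : 1 ≤ n) :
    ‖xiA c' D j (q ^ n) d h - 1 / (1 - ((q : ℂ))⁻¹) ^ 2‖ ≤
      2052 * ((|b1 c' D| + |b2 c' D| + |b3 c' D|) * Real.log q) * ((n : ℝ) + 1) ^ 3 := by
  set B : ℝ := |b1 c' D| + |b2 c' D| + |b3 c' D| with hBdef
  set u : ℂ := ((q : ℂ))⁻¹ with hu
  have hB0 : 0 ≤ B := by positivity
  have hlog : 0 ≤ Real.log q := Real.log_natCast_nonneg q
  have hBL : 0 ≤ B * Real.log q := mul_nonneg hB0 hlog
  have hq0 : (q : ℂ) ≠ 0 := by exact_mod_cast hq.ne_zero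
  have hq2 : (2 : ℝ) ≤ q := by exact_mod_cast hq.two_le
  have hqinv : (q : ℝ)⁻¹ ≤ 1 / 2 := inv_le_of_inv_le₀ (by norm_num) (by linarith)
  have hun : ‖u‖ ≤ 1 / 2 := by rw [hu, norm_inv, Complex.norm_natCast]; exact hqinv
  have hult : ‖u‖ < 1 := lt_of_le_of_lt hun (by norm_num)
  have hu1 : 1 - u ≠ 0 := by
    intro h0
    have : ‖(1 : ℂ)‖ ≤ 1 / 2 := by rw [show (1 : ℂ) = u by linear_combination h0]; exact hun
    rw [norm_one] at this; linarith
  have hqdh' : ¬ q ∣ d * h := (Nat.Prime.coprime_iff_not_dvd hq).mp hqdh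
  -- the exact form of the inner sum
  have hxi : xiA c' D j (q ^ n) d h =
      (∑' i : ℕ, kappaZ c' D (q ^ (n + i)) / ((q ^ i : ℕ) : ℂ) ^ (1 - betaJ c' D j)) -
        kappaZ c' D (q ^ (n - 1)) * (q : ℂ) ^ (1 - betaJ c' D j) / ((q : ℂ) - 1) := by
    rw [stepA_u010_holds c' D j d h q n hd hh hq hqD hcop hqdh hn,
      kappaTilde_prime_pow_of_not_dvd c' D hq (by omega) hqdh']
  -- `q^{1−β_j}/(q−1) = c₀ w`, `c₀ = 1/(1−u)`, `w = q^{−β_j}`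
  set c₀ : ℂ := 1 / (1 - u) with hc₀
  set w : ℂ := (q : ℂ) ^ (-betaJ c' D j) with hw
  have hc₀n : ‖c₀‖ ≤ 2 := by
    have hden : 1 / 2 ≤ ‖1 - u‖ := by
      linarith [norm_le_norm_add_norm_sub' (1 : ℂ) u, norm_one (α := ℂ)]
    rw [hc₀, norm_div, norm_one, div_le_iff₀ (by positivity)]
    linarith
  have hw1 : ‖w - 1‖ ≤ B * Real.log q :=
    le_trans (norm_cpow_neg_betaJ_sub_one_le c' D j hq.pos)
      (mul_le_mul_of_nonneg_right (norm_betaJ_le c' D j) hlog)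
  have hfrac : (q : ℂ) ^ (1 - betaJ c' D j) / ((q : ℂ) - 1) = c₀ * w := by
    have hq1 : (q : ℂ) - 1 ≠ 0 := by
      have : (1 : ℝ) < q := by exact_mod_cast hq.one_lt
      intro h0
      have h1 : (q : ℂ) = 1 := by linear_combination h0
      have : (q : ℝ) = 1 := by exact_mod_cast h1
      linarith
    rw [sub_eq_add_neg (1 : ℂ), Complex.cpow_add _ _ hq0, Complex.cpow_one, hc₀, hu, hw]
    field_simp
  -- the series part
  have hterm := fun i => case1_term_bound c' D j hq n i
  obtain ⟨hsum, hS⟩ := tsum_quartic_geom_bound (f := fun i : ℕ =>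
      kappaZ c' D (q ^ (n + i)) / ((q ^ i : ℕ) : ℂ) ^ (1 - betaJ c' D j) -
        ((n : ℂ) + i + 1) * ((q : ℂ)⁻¹) ^ i)
    (E := B * Real.log q * ((n : ℝ) + 1) ^ 3) (ρ := (q : ℝ)⁻¹) (by positivity) (by positivity) hqinv
    (fun i => by
      have := hterm i
      calc _ ≤ B * Real.log q * ((n : ℝ) + 1) ^ 3 * (((i : ℝ) + 2) ^ 4 * ((q : ℝ)⁻¹) ^ i) := this
        _ = B * Real.log q * ((n : ℝ) + 1) ^ 3 * ((i : ℝ) + 2) ^ 4 * ((q : ℝ)⁻¹) ^ i := by ring)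
  have hmainS := hasSum_affine_mul_geometric hult n
  have hsumY : Summable (fun i : ℕ =>
      kappaZ c' D (q ^ (n + i)) / ((q ^ i : ℕ) : ℂ) ^ (1 - betaJ c' D j)) :=
    (hsum.add hmainS.summable).congr (fun i => by ring)
  have hseries : ‖(∑' i : ℕ, kappaZ c' D (q ^ (n + i)) / ((q ^ i : ℕ) : ℂ) ^ (1 - betaJ c' D j)) -
      (((n : ℂ) + 1) / (1 - u) + u / (1 - u) ^ 2)‖ ≤ 2048 * (B * Real.log q * ((n : ℝ) + 1) ^ 3) := by
    rw [← hmainS.tsum_eq, ← hsumY.tsum_sub hmainS.summable]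
    exact hS
  -- the subtracted term
  have hsecond : ‖kappaZ c' D (q ^ (n - 1)) * w - (n : ℂ)‖ ≤ 2 * (B * Real.log q) * ((n : ℝ) + 1) ^ 2 := by
    obtain ⟨m, rfl⟩ : ∃ m, n = m + 1 := ⟨n - 1, by omega⟩
    rw [Nat.add_sub_cancel]
    have h := norm_kappa_prime_pow_sub_le (b1 c' D) (b2 c' D) (b3 c' D) hq m
    have hwn : ‖w‖ = 1 := by
      rw [hw, Complex.norm_natCast_cpow_of_pos hq.pos]
      have : (-betaJ c' D j).re = 0 := by
        rw [Complex.neg_re]; unfold betaJ beta1 beta2 beta3; split_ifs <;> simp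
      rw [this, Real.rpow_zero]
    have e2 : kappaZ c' D (q ^ m) * w - ((m + 1 : ℕ) : ℂ) =
        (kappaZ c' D (q ^ m) - ((m : ℂ) + 1)) * w + ((m : ℂ) + 1) * (w - 1) := by push_cast; ring
    rw [e2]
    have hr1 : ‖((m : ℂ) + 1)‖ = (m : ℝ) + 1 := by
      rw [show ((m : ℂ) + 1) = ((m + 1 : ℕ) : ℂ) by push_cast; ring, Complex.norm_natCast]
      push_cast; ring
    rw [kappaZ]
    calc _ ≤ ‖(kappa (b1 c' D) (b2 c' D) (b3 c' D) (q ^ m) - ((m : ℂ) + 1)) * w‖ +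
          ‖((m : ℂ) + 1) * (w - 1)‖ := norm_add_le _ _
      _ ≤ (m + 1) * m * B * Real.log q * 1 + ((m : ℝ) + 1) * (B * Real.log q) := by
          rw [norm_mul, norm_mul, hwn, hr1]
          exact add_le_add (mul_le_mul h (le_refl _) (by norm_num) (by positivity))
            (mul_le_mul_of_nonneg_left hw1 (by positivity))
      _ = (B * Real.log q) * (((m : ℝ) + 1) * m + ((m : ℝ) + 1)) := by ring
      _ ≤ 2 * (B * Real.log q) * (((m + 1 : ℕ) : ℝ) + 1) ^ 2 := by
          push_cast
          have hm0 : (0 : ℝ) ≤ m := Nat.cast_nonneg m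
          have hAC : ((m : ℝ) + 1) * m + ((m : ℝ) + 1) ≤ 2 * ((m : ℝ) + 1 + 1) ^ 2 := by nlinarith
          nlinarith [mul_le_mul_of_nonneg_left hAC hBL]
  -- assemble: `Σ − c₀(κw) − (1−u)^{-2} = [Σ − main] − c₀[κw − n]` with `main − c₀ n = (1−u)^{-2}`
  rw [hxi, mul_div_assoc, hfrac]
  have key : ((n : ℂ) + 1) / (1 - u) + u / (1 - u) ^ 2 - c₀ * (n : ℂ) = 1 / (1 - u) ^ 2 := by
    rw [hc₀]; field_simp; ring
  have e : (∑' i : ℕ, kappaZ c' D (q ^ (n + i)) / ((q ^ i : ℕ) : ℂ) ^ (1 - betaJ c' D j)) -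
      kappaZ c' D (q ^ (n - 1)) * (c₀ * w) - 1 / (1 - u) ^ 2 =
      ((∑' i : ℕ, kappaZ c' D (q ^ (n + i)) / ((q ^ i : ℕ) : ℂ) ^ (1 - betaJ c' D j)) -
        (((n : ℂ) + 1) / (1 - u) + u / (1 - u) ^ 2)) -
        c₀ * (kappaZ c' D (q ^ (n - 1)) * w - (n : ℂ)) := by
    rw [← key]; ring
  rw [e]
  calc _ ≤ ‖(∑' i : ℕ, kappaZ c' D (q ^ (n + i)) / ((q ^ i : ℕ) : ℂ) ^ (1 - betaJ c' D j)) -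
          (((n : ℂ) + 1) / (1 - u) + u / (1 - u) ^ 2)‖ +
        ‖c₀ * (kappaZ c' D (q ^ (n - 1)) * w - (n : ℂ))‖ := norm_sub_le _ _
    _ ≤ 2048 * (B * Real.log q * ((n : ℝ) + 1) ^ 3) + 2 * (2 * (B * Real.log q) * ((n : ℝ) + 1) ^ 2) := by
        rw [norm_mul]
        exact add_le_add hseries (mul_le_mul hc₀n hsecond (norm_nonneg _) (by norm_num))
    _ ≤ 2052 * (B * Real.log q) * ((n : ℝ) + 1) ^ 3 := by
        have hn1 : (1 : ℝ) ≤ (n : ℝ) + 1 := by linarith [(Nat.cast_nonneg n : (0:ℝ) ≤ n)]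
        have : ((n : ℝ) + 1) ^ 2 ≤ ((n : ℝ) + 1) ^ 3 := by nlinarith
        nlinarith [mul_le_mul_of_nonneg_left this hBL]

/-! ## Z22:§A.u013 -/

/-- **Z22:§A.u013 holds** (App. A p. 102, tex L5042): for `(q,dh) = 1`, `|s − 1| < 5α`, `q < D`,
`(q,D) = 1`: `‖Σ_r χ(q^r)ξ_j(q^r;d,h)/q^{rs} − (1−u)^{−2}(1/(1−vu) − 1)‖ ≤ C·α log q/q` for all
large `D` (`C = 2·10⁷`). [cite: Zhang2022LandauSiegel, App. A p. 102] -/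
theorem stepA_u013_holds (c' : ℝ) : StepA_u013 c' := by
  refine ⟨20000000, ⌈Real.exp (10 * |c'| * π + 400)⌉₊,
    fun D _ χ hD _ _ _ j _ d h hd hh _ q hq s hcond hqdh => ?_⟩
  have hD' : Real.exp (10 * |c'| * π + 400) ≤ D := le_trans (Nat.le_ceil _) (by exact_mod_cast hD)
  obtain ⟨hℓ3, hα, hB, hαℓ⟩ := largeD_bounds c' hD'
  obtain ⟨hs, hqD, hcop⟩ := hcond
  obtain ⟨hXu, hXn, hun, hqinv, hlogq, hlogq0⟩ := frame_X c' hD' hq hqD hs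
  set B : ℝ := |b1 c' D| + |b2 c' D| + |b3 c' D| with hBdef
  set v : ℂ := χ (q : ZMod D) with hv
  set X : ℂ := (q : ℂ) ^ (-s) with hX
  set u : ℂ := ((q : ℂ))⁻¹ with hu
  have hB0 : 0 ≤ B := by positivity
  have hvn : ‖v‖ ≤ 1 := χ.norm_le_one _
  have hvX : ‖v * X‖ ≤ 3 / 5 := by
    rw [norm_mul]; nlinarith [norm_nonneg v, norm_nonneg X]
  have hvu : ‖v * u‖ ≤ 3 / 5 := by
    rw [norm_mul]; nlinarith [norm_nonneg v, norm_nonneg u]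
  have hvXu : ‖v * X - v * u‖ ≤ 10 * alpha D * Real.log q * (q : ℝ)⁻¹ := by
    rw [← mul_sub, norm_mul]; nlinarith [norm_nonneg v, norm_nonneg (X - u)]
  have hvX2 : ‖v * X‖ ≤ 2 * (q : ℝ)⁻¹ := by
    have h1 : ‖X‖ ≤ ‖X - u‖ + ‖u‖ := by
      have := norm_add_le (X - u) u; rwa [sub_add_cancel] at this
    have h2 : ‖u‖ = (q : ℝ)⁻¹ := by rw [hu, norm_inv, Complex.norm_natCast]
    have h3 : 10 * alpha D * Real.log q * (q : ℝ)⁻¹ ≤ (q : ℝ)⁻¹ := by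
      have : 10 * alpha D * Real.log q ≤ 10 * (alpha D * ell D) := by
        calc _ ≤ 10 * alpha D * ell D := by gcongr
          _ = _ := by ring
      have hq0' : (0 : ℝ) ≤ (q : ℝ)⁻¹ := by positivity
      nlinarith
    calc ‖v * X‖ ≤ ‖X‖ := by rw [norm_mul]; nlinarith [norm_nonneg v, norm_nonneg X]
      _ ≤ 2 * (q : ℝ)⁻¹ := by linarith
  have hu1 : 1 - u ≠ 0 := by
    intro h0
    have : ‖(1 : ℂ)‖ ≤ 1 / 2 := by rw [show (1 : ℂ) = u by linear_combination h0]; exact hun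
    rw [norm_one] at this; linarith
  set m : ℂ := 1 / (1 - u) ^ 2 with hm
  have hmn : ‖m‖ ≤ 4 := by
    have hden : 1 / 2 ≤ ‖1 - u‖ := by
      linarith [norm_le_norm_add_norm_sub' (1 : ℂ) u, norm_one (α := ℂ)]
    rw [hm, norm_div, norm_one, norm_pow, div_le_iff₀ (by positivity)]
    nlinarith [pow_le_pow_left₀ (by norm_num : (0:ℝ) ≤ 1 / 2) hden 2]
  -- coefficients within `2052·B log q·(r+2)³` of `m`
  have hE : ∀ r : ℕ, ‖xiA c' D j (q ^ (r + 1)) d h - m‖ ≤ (2052 * (B * Real.log q)) * ((r : ℝ) + 2) ^ 3 :=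
    fun r => by
      have h := stepA_u012_corrected c' D j d h hq hd hh hqD hcop hqdh (n := r + 1) (by omega)
      calc _ ≤ 2052 * (B * Real.log q) * (((r + 1 : ℕ) : ℝ) + 1) ^ 3 := h
        _ = (2052 * (B * Real.log q)) * ((r : ℝ) + 2) ^ 3 := by push_cast; ring
  have hsplit : ∀ r : ℕ, (v * X) ^ (r + 1) * xiA c' D j (q ^ (r + 1)) d h =
      m * (v * X) ^ (r + 1) + (v * X) ^ (r + 1) * (xiA c' D j (q ^ (r + 1)) d h - m) := fun r => by
    ring
  obtain ⟨hsumR, hR⟩ := tsum_pow_succ_mul_cubic_bound hvX (by positivity) hE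
  have hlt : ‖v * X‖ < 1 := lt_of_le_of_lt hvX (by norm_num)
  have hmain := (hasSum_pow_succ' hlt).mul_left m
  rw [xiPowSum_eq c' χ j d h s hq.pos]
  have htot : ∑' r : ℕ, (v * X) ^ (r + 1) * xiA c' D j (q ^ (r + 1)) d h =
      m * (1 / (1 - v * X) - 1) +
        ∑' r : ℕ, (v * X) ^ (r + 1) * (xiA c' D j (q ^ (r + 1)) d h - m) := by
    rw [tsum_congr hsplit, hmain.summable.tsum_add hsumR, hmain.tsum_eq]
  rw [htot]
  have huA : uA q = u := rfl
  have hvA : vA χ q = v := rfl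
  rw [huA, hvA]
  have e : m * (1 / (1 - v * X) - 1) +
      (∑' r : ℕ, (v * X) ^ (r + 1) * (xiA c' D j (q ^ (r + 1)) d h - m)) -
      1 / (1 - u) ^ 2 * (1 / (1 - v * u) - 1) =
      m * (1 / (1 - v * X) - 1 / (1 - v * u)) +
        ∑' r : ℕ, (v * X) ^ (r + 1) * (xiA c' D j (q ^ (r + 1)) d h - m) := by
    rw [hm]; ring
  rw [e]
  calc _ ≤ ‖m * (1 / (1 - v * X) - 1 / (1 - v * u))‖ +
        ‖∑' r : ℕ, (v * X) ^ (r + 1) * (xiA c' D j (q ^ (r + 1)) d h - m)‖ := norm_add_le _ _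
    _ ≤ 4 * (25 / 4 * ‖v * X - v * u‖) + 640 * (2052 * (B * Real.log q)) * ‖v * X‖ := by
        rw [norm_mul]
        exact add_le_add (mul_le_mul hmn (norm_inv_sub_inv_le' hvX hvu) (norm_nonneg _) (by norm_num)) hR
    _ ≤ 4 * (25 / 4 * (10 * alpha D * Real.log q * (q : ℝ)⁻¹)) +
          640 * (2052 * ((7 * alpha D) * Real.log q)) * (2 * (q : ℝ)⁻¹) := by
        gcongr
    _ = 18385920 * (alpha D * Real.log q / q) + 250 * (alpha D * Real.log q / q) := by ring
    _ ≤ 20000000 * (alpha D * Real.log q / q) := by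
        have : 0 ≤ alpha D * Real.log q / q := by positivity
        nlinarith

variable (c' : ℝ) in
/-- `StepA_u013` — `_holds` alias of `stepA_u013_holds` above under the fact's exact name, stated under the
prover's own binders as section variables (appended 2026-08-28, D-0026 bookkeeping: the proof term is the
existing theorem of this file; no statement, definition or attribute is edited; no new named fact; the
ledger's debt table listed the fact unproved). [cite: Zhang2022LandauSiegel, App. A p. 102] -/
theorem _root_.Literature.NumberTheory.LFunctions.Zhang2022.Typed.AppendixA1.StepA_u013_holds :
    _root_.Literature.NumberTheory.LFunctions.Zhang2022.Typed.AppendixA1.StepA_u013 c' :=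
  _root_.Literature.NumberTheory.LFunctions.Zhang2022.Lemma83.stepA_u013_holds (c' := c')

/-! ## The deduction `DedA1` and (A.1) -/

/-- **`DedA1` holds** ("This together with [u014] and [u015] yields (A.1)", tex L5053):
`𝔱_j = pref·(1 + λ̃Σ)` with `pref = (1−vu) + O(ε)`, `λ̃ = (1−u)² + O(ε)`,
`Σ = (1−u)^{−2}(1/(1−vu) − 1) + O(ε)` ⇒ `𝔱_j = (1−vu)·(1/(1−vu)) + O(ε) = 1 + O(ε)`.
[cite: Zhang2022LandauSiegel, App. A p. 102] -/
theorem dedA1_holds (c' : ℝ) : DedA1 c' := by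
  intro h13 h14 h15
  obtain ⟨C₁, D₁, h₁⟩ := h13
  obtain ⟨C₂, D₂, h₂⟩ := h14
  obtain ⟨C₃, D₃, h₃⟩ := h15
  refine ⟨|C₃| * (1 + (9 / 4 + |C₂|) * (4 + |C₁|)) + 3 / 2 * (|C₂| * (4 + |C₁|) + 9 / 4 * |C₁|),
    max (max (max D₁ D₂) D₃) ⌈Real.exp (10 * |c'| * π + 400)⌉₊,
    fun D _ χ hD hquad hprim hA j hj d h hd hh hdh q hq s hcond hqdh => ?_⟩
  have hD1 : D₁ ≤ D :=
    le_trans (le_trans (le_trans (le_max_left _ _) (le_max_left _ _)) (le_max_left _ _)) hD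
  have hD2 : D₂ ≤ D :=
    le_trans (le_trans (le_trans (le_max_right _ _) (le_max_left _ _)) (le_max_left _ _)) hD
  have hD3 : D₃ ≤ D := le_trans (le_trans (le_max_right _ _) (le_max_left _ _)) hD
  have hD' : Real.exp (10 * |c'| * π + 400) ≤ D :=
    le_trans (Nat.le_ceil _) (by exact_mod_cast le_trans (le_max_right _ _) hD)
  have e13 := h₁ D χ hD1 hquad hprim hA j hj d h hd hh hdh q hq s hcond hqdh
  have e14 := h₂ D χ hD2 hquad hprim hA j hj d h hd hh hdh q hq hcond.2.1 hcond.2.2 hqdh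
  have e15 := h₃ D χ hD3 hquad hprim hA j hj q hq s hcond
  obtain ⟨ht0, ht1, hun⟩ := frame_t c' hD' hq hcond.2.1
  set t : ℝ := alpha D * Real.log q / q with htdef
  set v : ℂ := vA χ q with hv
  set u : ℂ := uA q with hu
  have hvn : ‖v‖ ≤ 1 := χ.norm_le_one _
  have hun' : ‖u‖ ≤ 1 / 2 := hun
  have hvu : ‖v * u‖ ≤ 1 / 2 := by rw [norm_mul]; nlinarith [norm_nonneg v, norm_nonneg u]
  have hden : 1 / 2 ≤ ‖1 - v * u‖ := by
    linarith [norm_le_norm_add_norm_sub' (1 : ℂ) (v * u), norm_one (α := ℂ)]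
  have hden0 : 1 - v * u ≠ 0 := fun h0 => by rw [h0, norm_zero] at hden; linarith
  have hdenu : 1 / 2 ≤ ‖1 - u‖ := by
    linarith [norm_le_norm_add_norm_sub' (1 : ℂ) u, norm_one (α := ℂ)]
  have hdenu0 : 1 - u ≠ 0 := fun h0 => by rw [h0, norm_zero] at hdenu; linarith
  set P : ℂ := 1 - v * u with hP
  set L : ℂ := (1 - u) ^ 2 with hL
  set M : ℂ := 1 / (1 - u) ^ 2 * (1 / (1 - v * u) - 1) with hM
  have hPn : ‖P‖ ≤ 3 / 2 := by
    calc ‖P‖ ≤ ‖(1 : ℂ)‖ + ‖v * u‖ := norm_sub_le _ _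
      _ ≤ 3 / 2 := by rw [norm_one]; linarith
  have hLn : ‖L‖ ≤ 9 / 4 := by
    have : ‖1 - u‖ ≤ 3 / 2 := by
      calc ‖1 - u‖ ≤ ‖(1 : ℂ)‖ + ‖u‖ := norm_sub_le _ _
        _ ≤ 3 / 2 := by rw [norm_one]; linarith
    rw [hL, norm_pow]; nlinarith [norm_nonneg (1 - u)]
  have hMn : ‖M‖ ≤ 4 := by
    have h1 : ‖1 / (1 - u) ^ 2‖ ≤ 4 := by
      rw [norm_div, norm_one, norm_pow, div_le_iff₀ (by positivity)]
      nlinarith [pow_le_pow_left₀ (by norm_num : (0:ℝ) ≤ 1 / 2) hdenu 2]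
    have h2 : ‖1 / (1 - v * u) - 1‖ ≤ 1 := by
      have hne : (1 : ℂ) - v * u ≠ 0 := by rw [← hP]; exact hden0
      have e : 1 / (1 - v * u) - 1 = v * u / (1 - v * u) := by field_simp; ring
      rw [e, norm_div, div_le_iff₀ (by positivity)]
      linarith
    rw [hM, norm_mul]; nlinarith [norm_nonneg (1 / (1 - u) ^ 2), norm_nonneg (1 / (1 - v * u) - 1)]
  have hPLM : P * (1 + L * M) = 1 := by
    have h1 : (1 : ℂ) - v * u ≠ 0 := by rw [← hP]; exact hden0
    rw [hP, hL, hM]; field_simp; ring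
  -- the three estimates with absolute constants
  have e13' : ‖xiPowSum c' χ j d h s q - M‖ ≤ |C₁| * t :=
    le_trans e13 (by rw [htdef]; exact mul_le_mul_of_nonneg_right (le_abs_self _) ht0)
  have e14' : ‖lamTilde c' D q (d * h) (1 - betaJ c' D j) - L‖ ≤ |C₂| * t :=
    le_trans e14 (by rw [htdef]; exact mul_le_mul_of_nonneg_right (le_abs_self _) ht0)
  have e15' : ‖pref c' χ j s q - P‖ ≤ |C₃| * t :=
    le_trans e15 (by rw [htdef]; exact mul_le_mul_of_nonneg_right (le_abs_self _) ht0)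
  have hXi : ‖xiPowSum c' χ j d h s q‖ ≤ 4 + |C₁| := by
    have e : xiPowSum c' χ j d h s q = (xiPowSum c' χ j d h s q - M) + M := by ring
    rw [e]
    calc _ ≤ ‖xiPowSum c' χ j d h s q - M‖ + ‖M‖ := norm_add_le _ _
      _ ≤ |C₁| * t + 4 := add_le_add e13' hMn
      _ ≤ 4 + |C₁| := by nlinarith [abs_nonneg C₁]
  have hLam : ‖lamTilde c' D q (d * h) (1 - betaJ c' D j)‖ ≤ 9 / 4 + |C₂| := by
    have e : lamTilde c' D q (d * h) (1 - betaJ c' D j) =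
        (lamTilde c' D q (d * h) (1 - betaJ c' D j) - L) + L := by ring
    rw [e]
    calc _ ≤ ‖lamTilde c' D q (d * h) (1 - betaJ c' D j) - L‖ + ‖L‖ := norm_add_le _ _
      _ ≤ |C₂| * t + 9 / 4 := add_le_add e14' hLn
      _ ≤ 9 / 4 + |C₂| := by nlinarith [abs_nonneg C₂]
  have hS : ‖1 + lamTilde c' D q (d * h) (1 - betaJ c' D j) * xiPowSum c' χ j d h s q‖ ≤
      1 + (9 / 4 + |C₂|) * (4 + |C₁|) := by
    calc _ ≤ ‖(1 : ℂ)‖ + ‖lamTilde c' D q (d * h) (1 - betaJ c' D j) * xiPowSum c' χ j d h s q‖ :=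
          norm_add_le _ _
      _ ≤ 1 + (9 / 4 + |C₂|) * (4 + |C₁|) := by
          rw [norm_one, norm_mul]
          exact add_le_add le_rfl (mul_le_mul hLam hXi (norm_nonneg _) (by positivity))
  -- assemble
  unfold frakt
  set Lt := lamTilde c' D q (d * h) (1 - betaJ c' D j) with hLt
  set Xs := xiPowSum c' χ j d h s q with hXs
  have e : pref c' χ j s q * (1 + Lt * Xs) - 1 =
      (pref c' χ j s q - P) * (1 + Lt * Xs) + P * ((Lt - L) * Xs + L * (Xs - M)) := by
    linear_combination hPLM
  rw [e]
  calc _ ≤ ‖(pref c' χ j s q - P) * (1 + Lt * Xs)‖ + ‖P * ((Lt - L) * Xs + L * (Xs - M))‖ :=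
        norm_add_le _ _
    _ ≤ |C₃| * t * (1 + (9 / 4 + |C₂|) * (4 + |C₁|)) +
          3 / 2 * (|C₂| * t * (4 + |C₁|) + 9 / 4 * (|C₁| * t)) := by
        rw [norm_mul, norm_mul]
        refine add_le_add (mul_le_mul e15' hS (norm_nonneg _) (by positivity))
          (mul_le_mul hPn ?_ (norm_nonneg _) (by norm_num))
        calc ‖(Lt - L) * Xs + L * (Xs - M)‖ ≤ ‖(Lt - L) * Xs‖ + ‖L * (Xs - M)‖ := norm_add_le _ _
          _ ≤ |C₂| * t * (4 + |C₁|) + 9 / 4 * (|C₁| * t) := by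
              rw [norm_mul, norm_mul]
              exact add_le_add (mul_le_mul e14' hXi (norm_nonneg _) (by positivity))
                (mul_le_mul hLn e13' (norm_nonneg _) (by norm_num))
    _ = (|C₃| * (1 + (9 / 4 + |C₂|) * (4 + |C₁|)) + 3 / 2 * (|C₂| * (4 + |C₁|) + 9 / 4 * |C₁|)) *
          (alpha D * Real.log q / q) := by rw [htdef]; ring

variable (c' : ℝ) in
/-- `DedA1` — `_holds` alias of `dedA1_holds` above under the fact's exact name, stated under the
prover's own binders as section variables (appended 2026-08-28, D-0026 bookkeeping: the proof term is the
existing theorem of this file; no statement, definition or attribute is edited; no new named fact; the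
ledger's debt table listed the fact unproved). [cite: Zhang2022LandauSiegel, App. A p. 102] -/
theorem _root_.Literature.NumberTheory.LFunctions.Zhang2022.Typed.AppendixA1.DedA1_holds :
    _root_.Literature.NumberTheory.LFunctions.Zhang2022.Typed.AppendixA1.DedA1 c' :=
  _root_.Literature.NumberTheory.LFunctions.Zhang2022.Lemma83.dedA1_holds (c' := c')

/-- **(A.1) holds** (Z22:(A.1), App. A p. 101, tex L5008): for `(q,dh) = 1`, `|s − 1| < 5α`,
`q < D`, `(q,D) = 1`: `𝔱_j(d,h,s;q) = 1 + O(α log q/q)` — by `DedA1` from u013, u014, u015.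
[cite: Zhang2022LandauSiegel, App. A (A.1) p. 101] -/
theorem eqA_1_holds (c' : ℝ) : EqA_1 c' :=
  dedA1_holds c' (stepA_u013_holds c') (stepA_u014_holds c') (stepA_u015_holds c')

variable (c' : ℝ) in
/-- `EqA_1` — `_holds` alias of `eqA_1_holds` above under the fact's exact name, stated under the
prover's own binders as section variables (appended 2026-08-28, D-0026 bookkeeping: the proof term is the
existing theorem of this file; no statement, definition or attribute is edited; no new named fact; the
ledger's debt table listed the fact unproved). [cite: Zhang2022LandauSiegel, App. A (A.1) p. 101] -/
theorem _root_.Literature.NumberTheory.LFunctions.Zhang2022.Typed.AppendixA1.EqA_1_holds :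
    _root_.Literature.NumberTheory.LFunctions.Zhang2022.Typed.AppendixA1.EqA_1 c' :=
  _root_.Literature.NumberTheory.LFunctions.Zhang2022.Lemma83.eqA_1_holds (c' := c')

end Literature.NumberTheory.LFunctions.Zhang2022.Lemma83
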